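import Mathlib.RingTheory.FormalGroup.Basic
import HarnessLib

/-!
# Descent of a formal group law to a subring along an injective ring map
# ([Lazard 1955] §II; [Hazewinkel 1978] §1.1 (1.1.6))

Topic `Literature/RingTheory/FormalGroups`; namespace `Literature.RingTheory.FormalGroups`.  One DEFINITION
(`FormalGroup.descend`) + fully proved theorems; no named fact, no instance, no `sorry`.  If `ι : A → K` is an INJECTIVE
ring homomorphism and `F` is a one-dimensional formal group law over `K` all of whose coefficients lie in the image of `ι`,
then the series `F₀ ∈ A⟦X,Y⟧` with `ι_* F₀ = F` is a formal group law over `A` (the axioms are identities between power series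
with coefficients in `ι(A)`, and `ι_*` is injective and commutes with substitution); `F₀` is commutative when `F` is.  This is
how the functional-equation laws (`F_V`, `F_U`, …) — constructed over `A ⊗ ℚ` — become laws over `A` once their
integrality is known.

* `FormalGroup.descend F ι hι h : FormalGroup A`, `FormalGroup.map_descend : (F.descend ι hι h).map ι = F`,
  `FormalGroup.coeff_descend`, `FormalGroup.descend_isComm`.

## References
* [Lazard1955] M. Lazard, Bull. SMF 83 (1955), §II («`u.f(x,y)` est une loi de groupe»).
* [Hazewinkel1978] M. Hazewinkel, *Formal Groups and Applications* (1978), §1.1 (1.1.6), §2.2 (integrality ⇒ law over `A`).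
-/

noncomputable section

namespace Literature.RingTheory.FormalGroups

open MvPowerSeries

universe u v

variable {A : Type u} {K : Type v} [CommRing A] [CommRing K]

/-- `ι_*` is injective on power series when `ι` is injective. [folklore] -/
private theorem map_injective_of_injective {τ : Type*} (ι : A →+* K) (hι : Function.Injective ι) :
    Function.Injective (MvPowerSeries.map (σ := τ) ι) := by
  intro F G h
  ext e
  apply hι
  rw [← coeff_map, ← coeff_map, h]

/-- `ι_*` on a `2`-vector of series (plumbing). [folklore] -/
private theorem map_vec2 {τ : Type*} (ι : A →+* K) (a b : MvPowerSeries τ A) :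
    (fun i => MvPowerSeries.map ι ((![a, b] : Fin 2 → MvPowerSeries τ A) i)) =
      ![MvPowerSeries.map ι a, MvPowerSeries.map ι b] := by
  funext i; fin_cases i <;> rfl

/-- **Descent of a formal group law along an injective ring map.**  Given `ι : A →+* K` injective and a law `F` over `K`
whose coefficients all lie in `ι(A)`, the unique series `F₀` over `A` with `ι_* F₀ = F` is a formal group law over `A`.
[cite: Hazewinkel1978, §1.1 (1.1.6)] -/
def FormalGroup.descend (F : FormalGroup K) (ι : A →+* K) (hι : Function.Injective ι)
    (h : ∀ e : Fin 2 →₀ ℕ, ∃ a : A, ι a = coeff e F.toPowerSeries) : FormalGroup A :=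
  have hmap : MvPowerSeries.map ι (fun e => Classical.choose (h e) : MvPowerSeries (Fin 2) A) = F.toPowerSeries := by
    ext e; rw [coeff_map]; exact Classical.choose_spec (h e)
  { toPowerSeries := fun e => Classical.choose (h e)
    zero_constantCoeff := by
      apply hι
      rw [← constantCoeff_map, hmap, F.zero_constantCoeff, map_zero]
    lin_coeff_X := by
      apply hι
      rw [← coeff_map, hmap, F.lin_coeff_X, map_one]
    lin_coeff_Y := by
      apply hι
      rw [← coeff_map, hmap, F.lin_coeff_Y, map_one]
    assoc := by
      set G : MvPowerSeries (Fin 2) A := fun e => Classical.choose (h e) with hG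
      have hG0 : constantCoeff G = 0 := by
        apply hι; rw [← constantCoeff_map, hmap, F.zero_constantCoeff, map_zero]
      apply map_injective_of_injective ι hι
      rw [map_subst (HasSubst.cons_subst_zero_left (0 : Fin 3) 1 2 hG0), map_vec2,
        map_subst HasSubst.X_X, map_vec2, map_X, map_X, map_X, hmap,
        map_subst (HasSubst.cons_subst_zero_right (0 : Fin 3) 1 2 hG0), map_vec2,
        map_subst HasSubst.X_X, map_vec2, map_X, map_X, map_X, hmap]
      exact F.assoc }

/-- The coefficients of the descended law map to those of `F`. [cite: Hazewinkel1978, §1.1 (1.1.6)] -/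
theorem FormalGroup.coeff_descend (F : FormalGroup K) (ι : A →+* K) (hι : Function.Injective ι)
    (h : ∀ e : Fin 2 →₀ ℕ, ∃ a : A, ι a = coeff e F.toPowerSeries) (e : Fin 2 →₀ ℕ) :
    ι (coeff e (FormalGroup.descend F ι hι h).toPowerSeries) = coeff e F.toPowerSeries :=
  Classical.choose_spec (h e)

/-- **`ι_* (descend F) = F`.** [cite: Hazewinkel1978, §1.1 (1.1.6)] -/
theorem FormalGroup.map_descend (F : FormalGroup K) (ι : A →+* K) (hι : Function.Injective ι)
    (h : ∀ e : Fin 2 →₀ ℕ, ∃ a : A, ι a = coeff e F.toPowerSeries) : (FormalGroup.descend F ι hι h).map ι = F := by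
  refine FormalGroup.ext ?_
  ext e
  rw [FormalGroup.map_toPowerSeries, coeff_map]
  exact FormalGroup.coeff_descend F ι hι h e

/-- The descended law is commutative when `F` is. [cite: Hazewinkel1978, §1.1 (1.1.6)] -/
theorem FormalGroup.descend_isComm (F : FormalGroup K) [hF : F.IsComm] (ι : A →+* K) (hι : Function.Injective ι)
    (h : ∀ e : Fin 2 →₀ ℕ, ∃ a : A, ι a = coeff e F.toPowerSeries) : (FormalGroup.descend F ι hι h).IsComm := by
  refine ⟨?_⟩
  have hmap : MvPowerSeries.map ι (FormalGroup.descend F ι hι h).toPowerSeries = F.toPowerSeries :=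
    congrArg FormalGroup.toPowerSeries (FormalGroup.map_descend F ι hι h)
  apply map_injective_of_injective ι hι
  change MvPowerSeries.map ι (FormalGroup.descend F ι hι h).toPowerSeries =
    MvPowerSeries.map ι ((FormalGroup.descend F ι hι h).toPowerSeries.subst ![X 1, X 0])
  rw [map_subst HasSubst.X_X, map_vec2, map_X, map_X, hmap]
  exact hF.comm

end Literature.RingTheory.FormalGroups
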